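import Summits.QuantumFields.YangMills.Theorems.BalabanUVNodesN15GenuineSiteKernelRate
import Summits.QuantumFields.YangMills.Theorems.BalabanUVNodesN15TwoGridEntry1
import Summits.QuantumFields.YangMills.Theorems.BalabanUVNodesN15VectorPieceUnitOwnForm
import Literature.MathematicalPhysics.QuantumFieldTheory.Balaban1983to89.T4EtaRateUnitWitness
import HarnessLib

/-!
# Route «BalabanUVNodes» (K4 «SpineRates»), node N15 = NE2 — THE GENUINE `U ≡ 1` UNIT-LATTICE LAYER: KING's FORM `Δ^{(k)} = a − a²QGQ*` OF BAŁABAN's FULL LANDAU-GAUGE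
# PROPAGATOR `G = Δ_b⁻¹` AT `U ≡ 1`, ITS INVERSE `C^{(k)}` FOR SMALL WEIGHT, THE THREE NE2⁰-TYPE UNIT LETTERS HYPOTHESIS-FREE ON THE TORUS FAMILY OF RECORD, AND THE NODE's
# THIRD CONJUNCT `NE2PlusUnit` ∕ `NE2ZeroUnit` BY NAME ON dag-n15-a's `tgInstance`

Cell `pub-ymgap`, seat `pub-ymgap-dag-n15-c` (generation g7; R134 ACCELERATION SEAT, strategy s1; HUMAN RULING D-0062; chair R424 venue; `bears_on: R4∕N15`).  Filed
`--kind proof --supports stmt-QuantumFields-20509 --as helper` (K3⁶ `SpineGivenEndpointR13SepCoPR`, dag-lead WORDS-142; count-neutral).  Imports BY NAME G1 `…N15GenuineSiteKernelRate` (→ dag-n15-a part 55 `tgInstance`, part 52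
`hasMaj_twoGridDefect` = ENTRY 0 of `𝔇(G′, G)` for the full pair, part 42 `ineq110_114_pair` ∕ `hasMaj_gOp_of_ineq` = the (1.110) majorants, part 26 `blkFine_comp_kingPrV`), dag-n15-a
part 59 `…N15TwoGridEntry1` (`hasMaj_twoGridDefect_grad` = ENTRY 1, hypothesis-free), this
seat's E2 `…N15VectorPieceUnitOwnForm` (`ownUnitInv`, `unitForm₀_comp_ownUnitInv`, `hasMaj_ownUnitInv`, `hasMaj_unitForm₀_sub`, `hasMaj_mulOp_const`, `mulOp_const_comp_inv`,
`ownRatio_eq`; → U1 `unitForm₀`, R1 `hasMaj_idef_unitForm₀`, S1 `hasMaj_idef_siteInv`, S3 `siteKernelOf`, U2 `ne2PlusUnit_opGeo_of_hasMaj`) and `T4EtaRateUnitWitness`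
(`ne2ZeroUnit_of_ne2PlusUnit`); nothing in the tree is modified.

WHY.  G1 made the genuine `U ≡ 1` SITE kernel's NE2⁰ letter a theorem on dag-n15-a's realised family `tgInstance` (the torus family of record); part 55 has the operator layer there
modulo entries 1–2.  The third layer — the UNIT-LATTICE covariance — had on that family only King's scalar `C^{(k)}` template (n15-a's knit, `θ = L⁻¹`, one-step).  This file
builds the genuine `U ≡ 1` unit layer of the FULL [B4-I] Landau-gauge propagator `G = Δ_b⁻¹` on real 1-forms (dag-n15-a `gOp`, (1.69)–(1.71)): King's unit form
`Δ^{(k)} = a·1 − a²·Q G Q*` ((2.14) p.653, `Q` = the unit-bond block mean `fibAvg qbond`, `Q*` = its pull-back) at both spacings of an η-pair, its inverse `(a·1 − a²QGQ*)⁻¹` by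
this seat's exact Neumann device (E2 `ownUnitInv`, small weight `|a| ≤ a₀`), and the three NE2⁰-type letters — inverse majorant, `Δ^{(k)}·C^{(k)} = 1`, and the η-DEFECT OF THE
INVERSES `𝔇(C′, C) = −C′·𝔇(Δ′, Δ)·C` (S1 `hasMaj_idef_siteInv`) with `𝔇(Δ′, Δ) = −a²·Q′·𝔇(G′, G)·Q*` (R1 `hasMaj_idef_unitForm₀`) fed by part 52's ENTRY 0 — HYPOTHESIS-FREE,
uniform in `(m_T, k, m)`.

WHAT THIS FILE IS (ns `Summit.QuantumFields.YangMills.BalabanUVNodes.N15.GenuineSite`).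
* §1 `card_fibre_kingPrV` (King's bond pairing has uniform fibres `(L^m)^{d+1}`), the data at an index `i` of the torus family of record: `kingFormC ∕ kingFormF d hL b a i` (the
  coarse ∕ fine unit forms of `gOp` at weight `a`), `kingInvC ∕ kingInvF` (their Neumann inverses), `kingUnitStep` (the η-difference `𝔇(C′, C)` of the inverses, identity
  transports on unit bonds).
* §2 ★★ **`genuineUnitLetters`**: for odd `L ≥ 3`, `b > 0` there is `a₀ > 0` such that for every weight `a ≠ 0`, `|a| ≤ a₀` there are `β_U ≥ 0`, `δ_U > 0`, `M_U ≥ 0` with, AT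
  EVERY index `i`: `C, C′ ≤ β_U·e^{−δ_U d}` (sharp unit-bond block norms), `Δ·C = 1 = Δ′·C′`, `𝔇(C′, C) ≤ M_U·(L^k)^{−¼}·e^{−δ_U d}` — every input a landed theorem.
* §3 the NODE-VOCABULARY READOUT: `genuineUnitKernel d hL b a i := siteKernelOf blkFine fst (𝔇(C′, C))` on `tgInstance d hL i`; ★★ **`ne2PlusUnit_genuineKingForm`**
  (`T4EtaRate.NE2PlusUnit c₃₅ (tgInstance d hL) (genuineUnitKernel d hL b a) ⊤ d`, clean rate `θ = L^{−¼}`; one-point carrier — the (3.35)∕(3.36) blocks are VOID, the «+» inert,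
  the content NE2⁰'s), ★★ **`ne2ZeroUnit_genuineKingForm`** (`NE2ZeroUnit …` BY NAME).
* §4 ★★★ **`n15At_fullG_genuine_of_entries12`**: `YMDAG.UVSplit.N15At` — ALL THREE CONJUNCTS BY NAME — for the record `⟨TGIndex, c₃₅, p, tgInstance, tgFamily b T1 T2,
  genuineSiteStep a_S, genuineUnitKernel b a, ⊤, d⟩`: GENUINE `U ≡ 1` objects on all three layers (operator = dag-n15-a part 55 `ne2PlusOperator_fullG_of_entries12`, entries 0∕3
  of the full pair PROVED, entries 1–2 the DISPLAYED binders `T1, T2` with uniform majorants; site = G1; unit = §3) — the node's conjunction for Bałaban's own `U ≡ 1` propagator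
  MODULO ENTRIES 1–2; ★★★ **`n15At_fullG_genuine_of_entry2`**: the same with ENTRY 1 DISCHARGED by dag-n15-a part 59 `hasMaj_twoGridDefect_grad` (hypothesis-free, rate
  `(L^k)^{−1∕16}`) at any direction selector `ν` (def `entry1Op`) — the only displayed binder left is the entry-2 operator `T2` (n15-a parts 61–64 in flight).

HONEST FRAMING ∕ LIMITS.  King's FORM of the unit-lattice action with Bałaban's full `U ≡ 1` Landau-gauge propagator inside (Bałaban's [B6] (2.156) `C^{(k)}` and King's (2.16)
`C^{(k)} = (Δ^{(k)} + aL^{−2}Q*Q)⁻¹` differ from this inverse by printed normalisations NOT tracked here); the inverse is produced by a Neumann series, so ONLY in a small-weight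
window `0 < |a| ≤ a₀` (King's `a` is not small: positivity of `Δ^{(k)}`, (4.33) p.674, is the printed mechanism — NOT used); fixed coupling `b` of `Δ_b` on both grids (part 52's
convention); torus family of record, odd `L ≥ 3`; constants crude and ours; MODEL-LEVEL.  NE2⁺ (background-dependent) NOT PRINTED, NOT proved, not claimed; count-neutral (typed
28∕28 · discharged 5∕27 of record unchanged); N15 NOT discharged; one finite T⁴ at fixed ε — NOT ℝ⁴, NOT infinite volume, NOT OS, NOT a mass gap, NOT Clay.
-/

noncomputable section

open scoped BigOperators
open Finset

namespace Summit.QuantumFields.YangMills.BalabanUVNodes.N15.GenuineSite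

open Literature.MathematicalPhysics.QuantumFieldTheory.Balaban1983to89
open Literature.MathematicalPhysics.QuantumFieldTheory.Balaban1983to89.B11SectG (BlockNorm HasMaj RowSum)
open Literature.MathematicalPhysics.QuantumFieldTheory.Balaban1983to89.B6RandomWalk (Triangle254)
open Literature.MathematicalPhysics.QuantumFieldTheory.Balaban1983to89.T4EtaRate (PairedInstance NE2PlusUnit EtaRateIneqUnit)
open Literature.MathematicalPhysics.QuantumFieldTheory.Balaban1983to89.T4EtaRateUnitWitness (NE2ZeroUnit ne2ZeroUnit_of_ne2PlusUnit)
open Literature.MathematicalPhysics.QuantumFieldTheory.Balaban1983to89.T4EtaRateDefect (idef)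
open Literature.MathematicalPhysics.QuantumFieldTheory.Balaban1983to89.T4EtaRateDefectSite (pt9Bg)
open Literature.MathematicalPhysics.QuantumFieldTheory.Balaban1983to89.T4EtaRateCoeffDefect (pull fibre)
open Literature.MathematicalPhysics.QuantumFieldTheory.Balaban1983to89.B5Prop11Plancherel (Tor fine)
open Literature.MathematicalPhysics.QuantumFieldTheory.Balaban1983to89.B6UnitTorusCarrier (unitTorusGeo unitTorusGeo_len triangle254_unitTorusGeo rowSum_unitTorusGeo)
open Literature.MathematicalPhysics.QuantumFieldTheory.Balaban1983to89.B6Prop26Gluing (mulOp)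
open Literature.MathematicalPhysics.QuantumFieldTheory.King1986.Torus (blockOf tdistT tdistT_nonneg tdistT_self)
open Summit.QuantumFields.YangMills.BalabanUVNodes.N15.OperatorReadout (opGeo realisedInstance)
open Summit.QuantumFields.YangMills.BalabanUVNodes.N15.SiteLayer (unitForm₀ ownUnitInv unitForm₀_comp_ownUnitInv hasMaj_ownUnitInv hasMaj_unitForm₀_sub hasMaj_mulOp_const
  mulOp_const_comp_inv ownRatio_eq hasMaj_idef_unitForm₀ hasMaj_idef_siteInv siteKernelOf etaRateIneqUnit_opGeo_of_hasMaj hasMaj_exp_mono)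
open Summit.QuantumFields.YangMills.BalabanUVNodes.N15.TwoGrid (TGIndex tgInstance tgGeoC tgGeoF tgPairing tgFamily gOp hasMaj_twoGridDefect ineq110_114_pair hasMaj_gOp_of_ineq
  rpow_neg_pow_eq ne2PlusOperator_fullG_of_entries12 symbOp sD hasMaj_twoGridDefect_grad)
open YMDAG.UVSplit (N15At)
open Summit.QuantumFields.YangMills.BalabanUVNodes.N15.VectorPiece (blkFine kingPr kingPrV kingPr_val qbond blkFine_comp_kingPrV)
open Summit.QuantumFields.YangMills.BalabanUVNodes.N15.DefectKernel (card_fibre_bondPair card_fibre_kingProj)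

variable {d : ℕ} {L : ℕ} [NeZero L]

/-! ## §1 King's unit form of the full propagator at the two spacings of an η-pair; its Neumann inverse -/

section Data

/-- King's bond pairing `prV` has UNIFORM fibres: exactly `(L^m)^{d+1}` fine bonds over every coarse bond (`card_fibre_bondPair` + `card_fibre_kingProj`).
[cite: King1986, p.664 (pairing convention «x′ ∈ B^n(x)»)] -/
theorem card_fibre_kingPrV (k m : ℕ) (M : Fin (d + 1) → ℕ) [∀ μ, NeZero (M μ)] (p : Tor (fine (L ^ k) M) × Fin (d + 1)) :
    (fibre (kingPrV L k m M) p).card = (L ^ m) ^ (d + 1) := by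
  obtain ⟨x, μ⟩ := p
  rw [card_fibre_bondPair (kingPr L k m M) (kingPrV L k m M) (fun _ => rfl) x μ]
  exact card_fibre_kingProj L k m M (kingPr L k m M) (kingPr_val L k m M) x

variable (d)

/-- KING's COARSE UNIT FORM `Δ^{(k)} = a·1 − a²·Q G Q*` of Bałaban's full `U ≡ 1` propagator `G = gOp (L^k) b` at weight `a`, on the unit-bond lattice of an index of the torus
family of record (`Q` = the unit-bond block mean `fibAvg qbond`). [cite: King1986, (2.14) p.653 (shape); Balaban1984PropagatorsI, (1.71) p.30 (the propagator)] -/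
def kingFormC (hL : Odd L ∧ 1 < L) (b a : ℝ) (i : TGIndex) : (Tor (TGIndex.Mn d hL i) × Fin (d + 1) → ℝ) →ₗ[ℝ] (Tor (TGIndex.Mn d hL i) × Fin (d + 1) → ℝ) :=
  unitForm₀ a (qbond L i.k (TGIndex.Mn d hL i)) (gOp (TGIndex.Mn d hL i) (L ^ i.k) b)

/-- KING's FINE UNIT FORM (propagator `gOp (L^m·L^k) b`, blocking through King's bond pairing). [cite: King1986, (2.14) p.653 (shape), p.664 (pairing)] -/
def kingFormF (hL : Odd L ∧ 1 < L) (b a : ℝ) (i : TGIndex) : (Tor (TGIndex.Mn d hL i) × Fin (d + 1) → ℝ) →ₗ[ℝ] (Tor (TGIndex.Mn d hL i) × Fin (d + 1) → ℝ) :=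
  unitForm₀ a (qbond L i.k (TGIndex.Mn d hL i) ∘ kingPrV L i.k i.m (TGIndex.Mn d hL i)) (gOp (TGIndex.Mn d hL i) (L ^ i.m * L ^ i.k) b)

/-- THE COARSE UNIT-LATTICE COVARIANCE `(a·1 − a²QGQ*)⁻¹` (E2's Neumann inverse `ownUnitInv`). [cite: King1986, (2.16) p.653 (shape); Balaban1985BackgroundPropagators, (3.67) p.403 (Neumann mechanism)] -/
def kingInvC (hL : Odd L ∧ 1 < L) (b a : ℝ) (i : TGIndex) : (Tor (TGIndex.Mn d hL i) × Fin (d + 1) → ℝ) →ₗ[ℝ] (Tor (TGIndex.Mn d hL i) × Fin (d + 1) → ℝ) :=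
  ownUnitInv a (qbond L i.k (TGIndex.Mn d hL i)) (gOp (TGIndex.Mn d hL i) (L ^ i.k) b)

/-- THE FINE UNIT-LATTICE COVARIANCE. [cite: King1986, (2.16) p.653 (shape)] -/
def kingInvF (hL : Odd L ∧ 1 < L) (b a : ℝ) (i : TGIndex) : (Tor (TGIndex.Mn d hL i) × Fin (d + 1) → ℝ) →ₗ[ℝ] (Tor (TGIndex.Mn d hL i) × Fin (d + 1) → ℝ) :=
  ownUnitInv a (qbond L i.k (TGIndex.Mn d hL i) ∘ kingPrV L i.k i.m (TGIndex.Mn d hL i)) (gOp (TGIndex.Mn d hL i) (L ^ i.m * L ^ i.k) b)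

/-- THE η-DIFFERENCE `𝔇(C′, C) = C′ − C` OF THE UNIT-LATTICE COVARIANCES across the runs `k`, `k + m` (identity pairing of unit bonds). [cite: King1986, Lemma 4.5 (4.38) p.674 (shape)] -/
def kingUnitStep (hL : Odd L ∧ 1 < L) (b a : ℝ) (i : TGIndex) : (Tor (TGIndex.Mn d hL i) × Fin (d + 1) → ℝ) →ₗ[ℝ] (Tor (TGIndex.Mn d hL i) × Fin (d + 1) → ℝ) :=
  idef LinearMap.id LinearMap.id (kingInvF d hL b a i) (kingInvC d hL b a i)

end Data

/-! ## §2 ★★ The three NE2⁰-type unit letters of the genuine form, hypothesis-free on the torus family -/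

section Letters

variable (d)

/-- ★★ **THE THREE UNIT LETTERS OF KING's FORM OF THE FULL `U ≡ 1` PROPAGATOR, HYPOTHESIS-FREE.**  For odd `L ≥ 3` and `b > 0` there is a weight window `a₀ > 0` such that for
every `a ≠ 0` with `|a| ≤ a₀` there are `β_U ≥ 0`, `δ_U > 0`, `M_U ≥ 0` with, at EVERY index of the torus family of record: the coarse and fine covariances have the majorant
`β_U·e^{−δ_U|y−y′|_T}` between the sharp unit-bond block norms (E2 `hasMaj_ownUnitInv` on the (1.110) majorants `ineq110_114_pair`), `Δ·C = 1 = Δ′·C′` (E2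
`unitForm₀_comp_ownUnitInv`), and `𝔇(C′, C) ≤ M_U·(L^k)^{−¼}·e^{−δ_U|y−y′|_T}` (S1's exact inverse rule `hasMaj_idef_siteInv`, the form's defect by R1 `hasMaj_idef_unitForm₀` from
dag-n15-a's ENTRY 0 `hasMaj_twoGridDefect` at `γ = ½`). [cite: King1986, (2.14)+(2.16) p.653, Lemma 4.5 (4.34)+(4.38) p.674 (shapes); Balaban1984PropagatorsI, Prop. 1.2 (1.110) p.35;
Balaban1985BackgroundPropagators, (3.67) p.403 (Neumann mechanism)] -/
theorem genuineUnitLetters (hLodd : Odd L) (hL2 : 2 ≤ L) (hL : Odd L ∧ 1 < L) {b : ℝ} (hb : 0 < b) :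
    ∃ a₀ : ℝ, 0 < a₀ ∧ ∀ a : ℝ, a ≠ 0 → |a| ≤ a₀ → ∃ βU δU MU : ℝ, 0 ≤ βU ∧ 0 < δU ∧ 0 ≤ MU ∧ ∀ i : TGIndex,
      HasMaj (BlockNorm.ofBlocks (unitTorusGeo L i.k (TGIndex.Mn d hL i)) (fun p : Tor (TGIndex.Mn d hL i) × Fin (d + 1) => p.1))
          (BlockNorm.ofBlocks (unitTorusGeo L i.k (TGIndex.Mn d hL i)) (fun p : Tor (TGIndex.Mn d hL i) × Fin (d + 1) => p.1)) (kingInvC d hL b a i)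
          (fun y y' => βU * Real.exp (-(δU * tdistT (TGIndex.Mn d hL i) y y'))) ∧
      HasMaj (BlockNorm.ofBlocks (unitTorusGeo L i.k (TGIndex.Mn d hL i)) (fun p : Tor (TGIndex.Mn d hL i) × Fin (d + 1) => p.1))
          (BlockNorm.ofBlocks (unitTorusGeo L i.k (TGIndex.Mn d hL i)) (fun p : Tor (TGIndex.Mn d hL i) × Fin (d + 1) => p.1)) (kingInvF d hL b a i)
          (fun y y' => βU * Real.exp (-(δU * tdistT (TGIndex.Mn d hL i) y y'))) ∧
      kingFormC d hL b a i ∘ₗ kingInvC d hL b a i = LinearMap.id ∧ kingFormF d hL b a i ∘ₗ kingInvF d hL b a i = LinearMap.id ∧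
      HasMaj (BlockNorm.ofBlocks (unitTorusGeo L i.k (TGIndex.Mn d hL i)) (fun p : Tor (TGIndex.Mn d hL i) × Fin (d + 1) => p.1))
          (BlockNorm.ofBlocks (unitTorusGeo L i.k (TGIndex.Mn d hL i)) (fun p : Tor (TGIndex.Mn d hL i) × Fin (d + 1) => p.1)) (kingUnitStep d hL b a i)
          (fun y y' => MU * ((L : ℝ) ^ i.k) ^ (-(1 / 4 : ℝ)) * Real.exp (-(δU * tdistT (TGIndex.Mn d hL i) y y'))) := by
  -- the (1.110) majorants of `G`, `G′` and ENTRY 0 of `𝔇(G′, G)`, uniform on the family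
  obtain ⟨δ₀, C₀, Cα, Cε, Cαε, hδ₀, hC₀, HP⟩ := ineq110_114_pair (d := d) hL hb
  obtain ⟨δ₂, C₂, hδ₂, hC₂, H0⟩ := hasMaj_twoGridDefect (d := d) hLodd hL2 hb (γ := 1 / 2) (by norm_num) (by norm_num)
  have hL0 : 0 < L := by omega
  -- common rate `δ`, row-sum rate `σ = δ/4`, output rate `ρ = δ/4`
  set δ : ℝ := min δ₀ δ₂ with hδdef
  have hδ : 0 < δ := lt_min hδ₀ hδ₂
  have hδδ₀ : δ ≤ δ₀ := min_le_left _ _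
  have hδδ₂ : δ ≤ δ₂ := min_le_right _ _
  set σ : ℝ := δ / 4 with hσdef
  have hσ : 0 < σ := by positivity
  set cr : ℝ := B4Sect5Proof.latticeConst (d + 1) σ with hcrdef
  have hcr : 0 ≤ cr := B4Sect5Proof.latticeConst_nonneg (d + 1) hσ.le
  refine ⟨(2 * (C₀ * cr * cr + 1))⁻¹, by positivity, fun a ha haa => ?_⟩
  have hapos : 0 < |a| := abs_pos.mpr ha
  have hsmall : |a| * C₀ * cr * cr < 1 := by
    have h1 : |a| * (C₀ * cr * cr) ≤ (2 * (C₀ * cr * cr + 1))⁻¹ * (C₀ * cr * cr) := mul_le_mul_of_nonneg_right haa (by positivity)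
    have h2 : (2 * (C₀ * cr * cr + 1))⁻¹ * (C₀ * cr * cr) < 1 := by
      rw [inv_mul_lt_iff₀ (by positivity)]; nlinarith [mul_nonneg (mul_nonneg hC₀.le hcr) hcr]
    nlinarith
  have hq1 : 0 < 1 - |a| * C₀ * cr * cr := by linarith
  set βU : ℝ := |a⁻¹| * (1 - |a| * C₀ * cr * cr)⁻¹ with hβUdef
  have hβU : 0 ≤ βU := mul_nonneg (abs_nonneg _) (inv_nonneg.mpr hq1.le)
  have hMU : 0 ≤ βU * (a * a * C₂) * βU * cr * cr :=
    mul_nonneg (mul_nonneg (mul_nonneg (mul_nonneg hβU (mul_nonneg (mul_self_nonneg a) hC₂.le)) hβU) hcr) hcr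
  refine ⟨βU, δ / 4, βU * (a * a * C₂) * βU * cr * cr, hβU, by positivity, hMU, fun i => ?_⟩
  -- the data at the index
  set M : Fin (d + 1) → ℕ := TGIndex.Mn d hL i with hM
  set k := i.k with hk
  set m := i.m with hm
  have hn1 : 1 ≤ L ^ k := Nat.one_le_pow _ _ hL0
  have hn'1 : 1 ≤ L ^ m * L ^ k := Nat.one_le_iff_ne_zero.mpr (Nat.mul_ne_zero (pow_ne_zero _ (NeZero.ne L)) (pow_ne_zero _ (NeZero.ne L)))
  haveI : NeZero (L ^ m * L ^ k) := ⟨Nat.mul_ne_zero (pow_ne_zero _ (NeZero.ne L)) (pow_ne_zero _ (NeZero.ne L))⟩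
  have htri := triangle254_unitTorusGeo L k M
  have hdist : ∀ y y' : (unitTorusGeo L k M).Site, 0 ≤ (unitTorusGeo L k M).dist y y' := fun y y' => tdistT_nonneg _ _ _
  have hd0 : ∀ y : (unitTorusGeo L k M).Site, (unitTorusGeo L k M).dist y y = 0 := fun y => tdistT_self _ _
  have hrow := rowSum_unitTorusGeo L k M hσ
  -- the (1.110) majorants at the common rate
  obtain ⟨HP1, HP2⟩ := HP i.mT k m i.one_le
  have hG : HasMaj (BlockNorm.ofBlocks (unitTorusGeo L k M) (blkFine L k M)) (BlockNorm.ofBlocks (unitTorusGeo L k M) (blkFine L k M)) (gOp M (L ^ k) b)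
      (fun y y' => C₀ * Real.exp (-(δ * (unitTorusGeo L k M).dist y y'))) :=
    hasMaj_exp_mono hdist hC₀.le hδδ₀ (hasMaj_gOp_of_ineq M k (L ^ k) b hn1 HP1 hC₀.le)
  have hG' : HasMaj (BlockNorm.ofBlocks (unitTorusGeo L k M) (blkFine L k M ∘ kingPrV L k m M))
      (BlockNorm.ofBlocks (unitTorusGeo L k M) (blkFine L k M ∘ kingPrV L k m M)) (gOp M (L ^ m * L ^ k) b)
      (fun y y' => C₀ * Real.exp (-(δ * (unitTorusGeo L k M).dist y y'))) := by
    rw [blkFine_comp_kingPrV M L k m]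
    exact hasMaj_exp_mono hdist hC₀.le hδδ₀ (hasMaj_gOp_of_ineq M k (L ^ m * L ^ k) b hn'1 HP2 hC₀.le)
  -- ENTRY 0 at the common rate, read with the `blkFine ∘ prV` blocking
  have hθ : 0 ≤ ((L : ℝ) ^ k) ^ (-(1 / 4 : ℝ)) := Real.rpow_nonneg (pow_nonneg (Nat.cast_nonneg _) _) _
  have hDG : HasMaj (BlockNorm.ofBlocks (unitTorusGeo L k M) (blkFine L k M)) (BlockNorm.ofBlocks (unitTorusGeo L k M) (blkFine L k M ∘ kingPrV L k m M))
      (idef (pull (kingPrV L k m M)) (pull (kingPrV L k m M)) (gOp M (L ^ m * L ^ k) b) (gOp M (L ^ k) b))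
      (fun y y' => C₂ * ((L : ℝ) ^ k) ^ (-(1 / 4 : ℝ)) * Real.exp (-(δ * (unitTorusGeo L k M).dist y y'))) := by
    rw [blkFine_comp_kingPrV M L k m]
    have e0 := H0 i.mT k m i.one_le hL
    have hcast : ((L ^ k : ℕ) : ℝ) = (L : ℝ) ^ k := by push_cast; ring
    have hq : (-((1 : ℝ) / 2 / 2)) = -(1 / 4) := by norm_num
    rw [hcast, hq] at e0
    exact hasMaj_exp_mono hdist (mul_nonneg hC₂.le hθ) hδδ₂ e0
  -- the letters of S1's exact inverse rule
  have hW := hasMaj_mulOp_const (g := unitTorusGeo L k M) (fun p : Tor M × Fin (d + 1) => p.1) hd0 a⁻¹ δ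
  have hC := hasMaj_unitForm₀_sub (g := unitTorusGeo L k M) (blkFine L k M) (fun p : Tor M × Fin (d + 1) => p.1) (qbond L k M) (fun _ => rfl) a hC₀.le hG
  have hC' := hasMaj_unitForm₀_sub (g := unitTorusGeo L k M) (blkFine L k M ∘ kingPrV L k m M) (fun p : Tor M × Fin (d + 1) => p.1)
    (qbond L k M ∘ kingPrV L k m M) (fun _ => rfl) a hC₀.le hG'
  have hDK := hasMaj_idef_unitForm₀ (g := unitTorusGeo L k M) (blkFine L k M) (fun p : Tor M × Fin (d + 1) => p.1) (qbond L k M) (kingPrV L k m M) (fun _ => rfl)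
    (pow_ne_zero _ (pow_ne_zero _ (NeZero.ne L))) (card_fibre_kingPrV k m M) a (mul_nonneg hC₂.le hθ) hDG
  have hqN : |a⁻¹| * (a * a * C₀) * cr * cr < 1 := by rw [ownRatio_eq ha]; exact hsmall
  -- the inverses: majorants and identities
  have hWs := hasMaj_ownUnitInv (g := unitTorusGeo L k M) (fun p : Tor M × Fin (d + 1) => p.1) (blkFine L k M) (qbond L k M) (fun _ => rfl) htri hdist hd0 hrow hσ.le hcr
    ha hC₀.le (show 0 ≤ δ / 4 by positivity) (by linarith) hG hsmall
  have hWs' := hasMaj_ownUnitInv (g := unitTorusGeo L k M) (fun p : Tor M × Fin (d + 1) => p.1) (blkFine L k M ∘ kingPrV L k m M) (qbond L k M ∘ kingPrV L k m M)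
    (fun _ => rfl) htri hdist hd0 hrow hσ.le hcr ha hC₀.le (show 0 ≤ δ / 4 by positivity) (by linarith) hG' hsmall
  have hKW := unitForm₀_comp_ownUnitInv (g := unitTorusGeo L k M) (fun p : Tor M × Fin (d + 1) => p.1) (blkFine L k M) (qbond L k M) (fun _ => rfl) htri hdist hd0 hrow
    hσ.le hcr ha hC₀.le (by linarith) hG hsmall
  have hKW' := unitForm₀_comp_ownUnitInv (g := unitTorusGeo L k M) (fun p : Tor M × Fin (d + 1) => p.1) (blkFine L k M ∘ kingPrV L k m M) (qbond L k M ∘ kingPrV L k m M)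
    (fun _ => rfl) htri hdist hd0 hrow hσ.le hcr ha hC₀.le (by linarith) hG' hsmall
  -- the defect of the inverses by the exact inverse rule
  have hDW := hasMaj_idef_siteInv (g := unitTorusGeo L k M) (fun p : Tor M × Fin (d + 1) => p.1) htri hdist hrow hσ.le hcr (abs_nonneg a⁻¹)
    (mul_nonneg (mul_self_nonneg a) hC₀.le) (mul_nonneg (mul_self_nonneg a) (mul_nonneg hC₂.le hθ)) (show 0 ≤ δ / 4 by positivity) (show δ / 4 + 3 * σ ≤ δ by linarith)
    hW hW hC hC' hDK (mulOp_const_comp_inv ha) (mulOp_const_comp_inv ha) hqN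
  rw [ownRatio_eq ha] at hDW
  refine ⟨hWs, hWs', hKW, hKW', ?_⟩
  exact hDW.mono fun y y' => le_of_eq (by ring)

end Letters

/-! ## §3 The node-vocabulary readout: `NE2PlusUnit` ∕ `NE2ZeroUnit` BY NAME for the genuine unit covariance on `tgInstance` -/

section Readout

variable (d)

/-- **THE GENUINE UNIT-LATTICE η-DIFFERENCE KERNEL on the realised paired-instance family of the torus family of record**: S3's site readout (largest `|entry|` over the
unit-bond blocks at `y`, `y′`) of `𝔇(C′, C)`, `C = (a·1 − a²QGQ*)⁻¹` King's covariance of Bałaban's full `U ≡ 1` propagator.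
[cite: King1986, (2.16) p.653, Lemma 4.5 (4.38) p.674 (the kernel and its η-difference: shapes); Balaban1985BackgroundPropagators, Thm 3.15 (3.187) p.432 (site reading)] -/
def genuineUnitKernel (hL : Odd L ∧ 1 < L) (b a : ℝ) (i : TGIndex) : B9.SiteKernel (tgInstance d hL i).gc (tgInstance d hL i).Bf :=
  show B9.SiteKernel (opGeo (unitTorusGeo L i.k (TGIndex.Mn d hL i)) (Tor (fine (L ^ i.k) (TGIndex.Mn d hL i)) × Fin (d + 1)) (blkFine L i.k (TGIndex.Mn d hL i))) pt9Bg from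
    siteKernelOf (g := unitTorusGeo L i.k (TGIndex.Mn d hL i)) (B := pt9Bg) (blkFine L i.k (TGIndex.Mn d hL i))
      (fun p : Tor (TGIndex.Mn d hL i) × Fin (d + 1) => p.1) (fun _ : Unit => kingUnitStep d hL b a i)

/-- Unfolding of `genuineUnitKernel` (S3's `siteKernelOf` of `𝔇(C′, C)` on the realised coarse geometry). [folklore] -/
theorem genuineUnitKernel_eq (hL : Odd L ∧ 1 < L) (b a : ℝ) (i : TGIndex) :
    genuineUnitKernel d hL b a i = siteKernelOf (g := unitTorusGeo L i.k (TGIndex.Mn d hL i)) (B := pt9Bg) (blkFine L i.k (TGIndex.Mn d hL i))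
      (fun p : Tor (TGIndex.Mn d hL i) × Fin (d + 1) => p.1) (fun _ : Unit => kingUnitStep d hL b a i) := rfl

/-- ★★ **`NE2PlusUnit` — THE NODE's THIRD CONJUNCT BY NAME — FOR KING's COVARIANCE OF BAŁABAN's FULL `U ≡ 1` LANDAU-GAUGE PROPAGATOR ON THE TORUS FAMILY OF RECORD**: for
odd `L ≥ 3`, `b > 0` there is `a₀ > 0` such that for every weight `a ≠ 0`, `|a| ≤ a₀` and every `c₃₅`:
`NE2PlusUnit c₃₅ (tgInstance d hL) (genuineUnitKernel d hL b a) ⊤ d` with the CLEAN rate `θ = L^{−¼}` (U2 `ne2PlusUnit_opGeo_of_hasMaj` on `genuineUnitLetters`).  HONEST SCOPE: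
one-point background carrier — (3.35)∕(3.36) VOID there, the «+» inert, the content NE2⁰'s; Neumann window in the weight; King's form, Bałaban's propagator, printed normalisations
not tracked. [cite: Balaban1985BackgroundPropagators, Thm 3.15 (3.187) p.432 (quantifier template); King1986, Lemma 4.5 (4.38) p.674 (A = 0 template)] -/
theorem ne2PlusUnit_genuineKingForm (hLodd : Odd L) (hL2 : 2 ≤ L) (hL : Odd L ∧ 1 < L) {b : ℝ} (hb : 0 < b) :
    ∃ a₀ : ℝ, 0 < a₀ ∧ ∀ a : ℝ, a ≠ 0 → |a| ≤ a₀ → ∀ c35 : ℝ,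
      NE2PlusUnit c35 (tgInstance d hL) (genuineUnitKernel d hL b a) (fun _ _ => True) (fun i => (tgGeoC d hL i).dist) := by
  obtain ⟨a₀, ha₀, H⟩ := genuineUnitLetters d hLodd hL2 hL hb
  refine ⟨a₀, ha₀, fun a ha haa c35 => ?_⟩
  obtain ⟨βU, δU, MU, _, hδU, hMU, HL⟩ := H a ha haa
  have hL1 : (1 : ℝ) < (L : ℝ) := by exact_mod_cast (show 1 < L by omega)
  have hθpos : 0 < (L : ℝ) ^ (-(1 / 4 : ℝ)) := Real.rpow_pos_of_pos (by positivity) _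
  have hθ1 : (L : ℝ) ^ (-(1 / 4 : ℝ)) < 1 := Real.rpow_lt_one_of_one_lt_of_neg hL1 (by norm_num)
  refine ⟨δU, 1, MU + 1, (L : ℝ) ^ (-(1 / 4 : ℝ)), hδU, one_pos, by positivity, hθpos, hθ1, fun i α₀ _ _ U _ _ => ?_⟩
  show EtaRateIneqUnit (genuineUnitKernel d hL b a i) (fun _ => True) (tgGeoC d hL i).dist (MU + 1) δU ((L : ℝ) ^ (-(1 / 4 : ℝ))) i.k U
  rw [genuineUnitKernel_eq]
  refine etaRateIneqUnit_opGeo_of_hasMaj (g := unitTorusGeo L i.k (TGIndex.Mn d hL i)) (B := pt9Bg) (blkFine L i.k (TGIndex.Mn d hL i))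
    (fun p : Tor (TGIndex.Mn d hL i) × Fin (d + 1) => p.1) i.k (by positivity) hθpos.le (fun _ : Unit => kingUnitStep d hL b a i) U ?_
  rw [rpow_neg_pow_eq (1 / 4) i.k]
  have hcast : ((L ^ i.k : ℕ) : ℝ) = (L : ℝ) ^ i.k := by push_cast; ring
  rw [hcast]
  refine ((HL i).2.2.2.2).mono fun y y' => ?_
  have hθ : 0 ≤ ((L : ℝ) ^ i.k) ^ (-(1 / 4 : ℝ)) := Real.rpow_nonneg (pow_nonneg (Nat.cast_nonneg _) _) _
  have hE := Real.exp_nonneg (-(δU * tdistT (TGIndex.Mn d hL i) y y'))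
  show MU * ((L : ℝ) ^ i.k) ^ (-(1 / 4 : ℝ)) * Real.exp (-(δU * tdistT (TGIndex.Mn d hL i) y y'))
    ≤ (MU + 1) * Real.exp (-(δU * tdistT (TGIndex.Mn d hL i) y y')) * ((L : ℝ) ^ i.k) ^ (-(1 / 4 : ℝ))
  nlinarith [mul_nonneg hθ hE]

/-- ★★ **`NE2ZeroUnit` FOR KING's COVARIANCE OF BAŁABAN's FULL `U ≡ 1` PROPAGATOR ON THE TORUS FAMILY OF RECORD** — the NE2⁰-unit letter BY NAME (small weight window; odd
`L ≥ 3`, `b > 0`). [cite: King1986, Lemma 4.5 (4.38) p.674 (A = 0 template); Balaban1985BackgroundPropagators, Thm 3.15 (3.187) p.432 (shape)] -/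
theorem ne2ZeroUnit_genuineKingForm (hLodd : Odd L) (hL2 : 2 ≤ L) (hL : Odd L ∧ 1 < L) {b : ℝ} (hb : 0 < b) :
    ∃ a₀ : ℝ, 0 < a₀ ∧ ∀ a : ℝ, a ≠ 0 → |a| ≤ a₀ →
      NE2ZeroUnit (tgInstance d hL) (genuineUnitKernel d hL b a) (fun _ _ => True) (fun i => (tgGeoC d hL i).dist) := by
  obtain ⟨a₀, ha₀, H⟩ := ne2PlusUnit_genuineKingForm d hLodd hL2 hL hb
  refine ⟨a₀, ha₀, fun a ha haa => ?_⟩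
  exact ne2ZeroUnit_of_ne2PlusUnit (c35 := 0) (fun i => by show (0 : ℝ) < 1; exact one_pos) (fun _ _ _ => trivial) (fun _ _ _ => trivial) (H a ha haa 0)

end Readout

/-! ## §4 ★★★ `N15At` — all three conjuncts BY NAME — for GENUINE `U ≡ 1` objects on the torus family of record, modulo entries 1–2 of the operator layer -/

section Node

variable (d)

/-- ★★★ **`N15At` FOR GENUINE `U ≡ 1` OBJECTS ON THE TORUS FAMILY OF RECORD, MODULO ENTRIES 1–2.**  For odd `L ≥ 3`, couplings `b, a_S > 0`: there is a weight window `a₀ > 0`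
such that for every `a ≠ 0`, `|a| ≤ a₀`, every `c₃₅` and `p`, and every pair of entry-1∕2 operators `T1, T2` with UNIFORM block majorants `B₁·(L^k)^{−γ₁}·e^{−δ₁|y−y′|_T}`
(`γ₁, δ₁ > 0` — dag-n15-a part 55's displayed binders, their located input (1.112)), `YMDAG.UVSplit.N15At` holds for the record
`⟨TGIndex, c₃₅, p, tgInstance, tgFamily b T1 T2, genuineSiteStep a_S, genuineUnitKernel b a, ⊤, d⟩`: OPERATOR = dag-n15-a `ne2PlusOperator_fullG_of_entries12` (entries 0 and 3 of
Bałaban's full Landau-gauge pair `(Δ′_b⁻¹, Δ_b⁻¹)` PROVED), SITE = G1 `ne2PlusSite_genuineSite` ([B5]'s `(Q′G′²Q′*)⁻¹` at King's couplings built on `a_S`), UNIT = §3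
`ne2PlusUnit_genuineKingForm` (King's covariance of `Δ_b⁻¹`).  One-point background carrier: the «+» blocks are inert, the content is NE2⁰'s on all three layers — said.
[cite: Balaban1985BackgroundPropagators, Thm 3.1 p.397, Thm 3.2 (3.48) p.398, Thm 3.15 (3.187) p.432 (the three layers' templates); King1986, Props. 3.8–3.9 pp.664–665, Lemma 4.5 (4.38) p.674 (A = 0 templates)] -/
theorem n15At_fullG_genuine_of_entries12 (hLodd : Odd L) (hL2 : 2 ≤ L) (hL : Odd L ∧ 1 < L) {b aS : ℝ} (hb : 0 < b) (haS : 0 < aS)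
    (T1 T2 : ∀ i : TGIndex, (Tor (fine (L ^ i.k) (TGIndex.Mn d hL i)) × Fin (d + 1) → ℝ) →ₗ[ℝ] (Tor (fine (L ^ i.m * L ^ i.k) (TGIndex.Mn d hL i)) × Fin (d + 1) → ℝ))
    {B₁ γ₁ δ₁ : ℝ} (hγ₁ : 0 < γ₁) (hδ₁ : 0 < δ₁)
    (h1 : ∀ i : TGIndex, HasMaj (BlockNorm.ofBlocks (unitTorusGeo L i.k (TGIndex.Mn d hL i)) (blkFine L i.k (TGIndex.Mn d hL i)))
      (BlockNorm.ofBlocks (unitTorusGeo L i.k (TGIndex.Mn d hL i))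
        (fun j : Tor (fine (L ^ i.m * L ^ i.k) (TGIndex.Mn d hL i)) × Fin (d + 1) => blockOf (L ^ i.m * L ^ i.k) (TGIndex.Mn d hL i) j.1)) (T1 i)
      (fun y y' => B₁ * ((L : ℝ) ^ i.k) ^ (-γ₁) * Real.exp (-(δ₁ * tdistT (TGIndex.Mn d hL i) y y'))))
    (h2 : ∀ i : TGIndex, HasMaj (BlockNorm.ofBlocks (unitTorusGeo L i.k (TGIndex.Mn d hL i)) (blkFine L i.k (TGIndex.Mn d hL i)))
      (BlockNorm.ofBlocks (unitTorusGeo L i.k (TGIndex.Mn d hL i))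
        (fun j : Tor (fine (L ^ i.m * L ^ i.k) (TGIndex.Mn d hL i)) × Fin (d + 1) => blockOf (L ^ i.m * L ^ i.k) (TGIndex.Mn d hL i) j.1)) (T2 i)
      (fun y y' => B₁ * ((L : ℝ) ^ i.k) ^ (-γ₁) * Real.exp (-(δ₁ * tdistT (TGIndex.Mn d hL i) y y')))) :
    ∃ a₀ : ℝ, 0 < a₀ ∧ ∀ a : ℝ, a ≠ 0 → |a| ≤ a₀ → ∀ c35 p : ℝ,
      N15At { I := TGIndex, c35 := c35, p := p, pi := tgInstance d hL, Kop := tgFamily d hL b T1 T2, Ksite := genuineSiteStep d hL aS,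
              Kunit := genuineUnitKernel d hL b a, inΛ := fun _ _ => True, unitDist := fun i => (tgGeoC d hL i).dist } := by
  obtain ⟨a₀, ha₀, HU⟩ := ne2PlusUnit_genuineKingForm d hLodd hL2 hL hb
  exact ⟨a₀, ha₀, fun a ha haa c35 p => ⟨ne2PlusOperator_fullG_of_entries12 (d := d) hLodd hL2 hL hb c35 T1 T2 hγ₁ hδ₁ h1 h2,
    ne2PlusSite_genuineSite (d := d) hLodd hL2 hL haS 4 p c35, HU a ha haa c35⟩⟩

/-- THE ENTRY-1 OPERATOR OF THE FULL PAIR at a chosen direction `ν(i)` per index: `𝔇(∇_νG) = ∇′_νG′P − P∇_νG` (`∇_ν = symbOp (sD ν n)`, King's prolongation `P = pull prV`) —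
dag-n15-a part 59's object. [cite: Balaban1985BackgroundPropagators, (3.42) p.397 (entry 1: shape)] -/
def entry1Op (hL : Odd L ∧ 1 < L) (b : ℝ) (ν : TGIndex → Fin (d + 1)) (i : TGIndex) :
    (Tor (fine (L ^ i.k) (TGIndex.Mn d hL i)) × Fin (d + 1) → ℝ) →ₗ[ℝ] (Tor (fine (L ^ i.m * L ^ i.k) (TGIndex.Mn d hL i)) × Fin (d + 1) → ℝ) :=
  idef (pull (kingPrV L i.k i.m (TGIndex.Mn d hL i))) (pull (kingPrV L i.k i.m (TGIndex.Mn d hL i)))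
    (symbOp (TGIndex.Mn d hL i) (L ^ i.m * L ^ i.k) (sD (TGIndex.Mn d hL i) (L ^ i.m * L ^ i.k) (ν i) ((L ^ i.m * L ^ i.k : ℕ) : ℝ)) ∘ₗ
      gOp (TGIndex.Mn d hL i) (L ^ i.m * L ^ i.k) b)
    (symbOp (TGIndex.Mn d hL i) (L ^ i.k) (sD (TGIndex.Mn d hL i) (L ^ i.k) (ν i) ((L ^ i.k : ℕ) : ℝ)) ∘ₗ gOp (TGIndex.Mn d hL i) (L ^ i.k) b)

/-- ★★★ **`N15At` FOR GENUINE `U ≡ 1` OBJECTS, MODULO ENTRY 2 ONLY**: as `n15At_fullG_genuine_of_entries12` with ENTRY 1 DISCHARGED by dag-n15-a part 59 `hasMaj_twoGridDefect_grad`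
(`𝔇(∇_νG) ≤ C·(L^k)^{−1∕16}·e^{−δ|y−y′|_T}`, hypothesis-free) at any direction selector `ν : TGIndex → Fin (d+1)`; the only displayed binder is the entry-2 operator `T2` (`𝔇(G∇*)`) with a
uniform majorant (n15-a's parts 61–64, in flight).  Record: `⟨TGIndex, c₃₅, p, tgInstance, tgFamily b (entry1Op b ν) T2, genuineSiteStep a_S, genuineUnitKernel b a, ⊤, d⟩`.
[cite: Balaban1985BackgroundPropagators, Thm 3.1 (3.42) p.397, Thm 3.2 (3.48) p.398, Thm 3.15 (3.187) p.432 (templates); King1986, Props. 3.8–3.9 pp.664–665, Lemma 4.5 (4.38) p.674] -/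
theorem n15At_fullG_genuine_of_entry2 (hLodd : Odd L) (hL2 : 2 ≤ L) (hL : Odd L ∧ 1 < L) {b aS : ℝ} (hb : 0 < b) (haS : 0 < aS) (ν : TGIndex → Fin (d + 1))
    (T2 : ∀ i : TGIndex, (Tor (fine (L ^ i.k) (TGIndex.Mn d hL i)) × Fin (d + 1) → ℝ) →ₗ[ℝ] (Tor (fine (L ^ i.m * L ^ i.k) (TGIndex.Mn d hL i)) × Fin (d + 1) → ℝ))
    {B₂ γ₂ δ₂ : ℝ} (hγ₂ : 0 < γ₂) (hδ₂ : 0 < δ₂)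
    (h2 : ∀ i : TGIndex, HasMaj (BlockNorm.ofBlocks (unitTorusGeo L i.k (TGIndex.Mn d hL i)) (blkFine L i.k (TGIndex.Mn d hL i)))
      (BlockNorm.ofBlocks (unitTorusGeo L i.k (TGIndex.Mn d hL i))
        (fun j : Tor (fine (L ^ i.m * L ^ i.k) (TGIndex.Mn d hL i)) × Fin (d + 1) => blockOf (L ^ i.m * L ^ i.k) (TGIndex.Mn d hL i) j.1)) (T2 i)
      (fun y y' => B₂ * ((L : ℝ) ^ i.k) ^ (-γ₂) * Real.exp (-(δ₂ * tdistT (TGIndex.Mn d hL i) y y')))) :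
    ∃ a₀ : ℝ, 0 < a₀ ∧ ∀ a : ℝ, a ≠ 0 → |a| ≤ a₀ → ∀ c35 p : ℝ,
      N15At { I := TGIndex, c35 := c35, p := p, pi := tgInstance d hL, Kop := tgFamily d hL b (entry1Op d hL b ν) T2, Ksite := genuineSiteStep d hL aS,
              Kunit := genuineUnitKernel d hL b a, inΛ := fun _ _ => True, unitDist := fun i => (tgGeoC d hL i).dist } := by
  obtain ⟨δ₁, C₁, hδ₁, hC₁, H1⟩ := hasMaj_twoGridDefect_grad (d := d) hLodd hL2 hb
  -- one triple `(B, γ, δ)` for both displayed slots of `_of_entries12`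
  have hL1 : (1 : ℝ) ≤ (L : ℝ) := by exact_mod_cast (show 1 ≤ L by omega)
  have hB0 : 0 ≤ max C₁ B₂ := hC₁.le.trans (le_max_left _ _)
  have hmono : ∀ (i : TGIndex) {B' e δ' : ℝ}, B' ≤ max C₁ B₂ → min (1 / 16) γ₂ ≤ e → min δ₁ δ₂ ≤ δ' → ∀ y y' : Tor (TGIndex.Mn d hL i),
      B' * ((L : ℝ) ^ i.k) ^ (-e) * Real.exp (-(δ' * tdistT (TGIndex.Mn d hL i) y y'))
        ≤ max C₁ B₂ * ((L : ℝ) ^ i.k) ^ (-min (1 / 16) γ₂) * Real.exp (-(min δ₁ δ₂ * tdistT (TGIndex.Mn d hL i) y y')) := by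
    intro i B' e δ' hB' he hδ' y y'
    have hx1 : (1 : ℝ) ≤ (L : ℝ) ^ i.k := one_le_pow₀ hL1
    have hr : ((L : ℝ) ^ i.k) ^ (-e) ≤ ((L : ℝ) ^ i.k) ^ (-min (1 / 16) γ₂) := Real.rpow_le_rpow_of_exponent_le hx1 (neg_le_neg he)
    have hr0 : 0 ≤ ((L : ℝ) ^ i.k) ^ (-e) := Real.rpow_nonneg (by positivity) _
    have hex : Real.exp (-(δ' * tdistT (TGIndex.Mn d hL i) y y')) ≤ Real.exp (-(min δ₁ δ₂ * tdistT (TGIndex.Mn d hL i) y y')) :=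
      Real.exp_le_exp.mpr (neg_le_neg (mul_le_mul_of_nonneg_right hδ' (tdistT_nonneg _ _ _)))
    by_cases hB'0 : 0 ≤ B'
    · exact mul_le_mul (mul_le_mul hB' hr hr0 hB0) hex (Real.exp_nonneg _) (mul_nonneg hB0 (Real.rpow_nonneg (by positivity) _))
    · exact (mul_nonpos_of_nonpos_of_nonneg (mul_nonpos_of_nonpos_of_nonneg (le_of_lt (not_le.mp hB'0)) hr0) (Real.exp_nonneg _)).trans
        (mul_nonneg (mul_nonneg hB0 (Real.rpow_nonneg (by positivity) _)) (Real.exp_nonneg _))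
  have h1' : ∀ i : TGIndex, HasMaj (BlockNorm.ofBlocks (unitTorusGeo L i.k (TGIndex.Mn d hL i)) (blkFine L i.k (TGIndex.Mn d hL i)))
      (BlockNorm.ofBlocks (unitTorusGeo L i.k (TGIndex.Mn d hL i))
        (fun j : Tor (fine (L ^ i.m * L ^ i.k) (TGIndex.Mn d hL i)) × Fin (d + 1) => blockOf (L ^ i.m * L ^ i.k) (TGIndex.Mn d hL i) j.1)) (entry1Op d hL b ν i)
      (fun y y' => max C₁ B₂ * ((L : ℝ) ^ i.k) ^ (-min (1 / 16) γ₂) * Real.exp (-(min δ₁ δ₂ * tdistT (TGIndex.Mn d hL i) y y'))) := by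
    intro i
    have e1 := H1 i.mT i.k i.m i.one_le hL (ν i)
    have hcast : ((L ^ i.k : ℕ) : ℝ) = (L : ℝ) ^ i.k := by push_cast; ring
    exact e1.mono fun y y' => by rw [hcast]; exact hmono i (le_max_left _ _) (min_le_left _ _) (min_le_left _ _) y y'
  have h2' : ∀ i : TGIndex, HasMaj (BlockNorm.ofBlocks (unitTorusGeo L i.k (TGIndex.Mn d hL i)) (blkFine L i.k (TGIndex.Mn d hL i)))
      (BlockNorm.ofBlocks (unitTorusGeo L i.k (TGIndex.Mn d hL i))
        (fun j : Tor (fine (L ^ i.m * L ^ i.k) (TGIndex.Mn d hL i)) × Fin (d + 1) => blockOf (L ^ i.m * L ^ i.k) (TGIndex.Mn d hL i) j.1)) (T2 i)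
      (fun y y' => max C₁ B₂ * ((L : ℝ) ^ i.k) ^ (-min (1 / 16) γ₂) * Real.exp (-(min δ₁ δ₂ * tdistT (TGIndex.Mn d hL i) y y'))) := fun i =>
    (h2 i).mono fun y y' => hmono i (le_max_right _ _) (min_le_right _ _) (min_le_right _ _) y y'
  exact n15At_fullG_genuine_of_entries12 d hLodd hL2 hL hb haS (entry1Op d hL b ν) T2 (lt_min (by norm_num) hγ₂) (lt_min hδ₁ hδ₂) h1' h2'

end Node

end Summit.QuantumFields.YangMills.BalabanUVNodes.N15.GenuineSite
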